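import Literature.MathematicalPhysics.KineticTheory.BackwardCluster
import Literature.MathematicalPhysics.KineticTheory.HardSphereEuler
import HarnessLib

/-!
# Ring closures of a hard-sphere collision history and the dressed ring bubble `R(φ)`

Definition item `defn-dressedRingBubble` (topic `Literature/MathematicalPhysics/KineticTheory`):
the objects posited by route `LaceRingBootstrap` of `AtomisticToContinuum/HydrodynamicLimit`,
needed to type its items `DressedBubbleBound` and `LaceSelfEnergyBounds`. On a hard-sphere
trajectory (`Literature.Analysis.FluidPDE.IsHardSphereTrajectory`, an orbit of a
`HardSphereFlow`) one reads off the collision record `(t_m, {p_m, q_m})` (APST 2015 §5; here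
`collisionRecord` of `BackwardCluster.lean`, window `(t₀, t]`) and builds:

* the **causal order** on collision events — `DirectlyPrecedes R e e'` (strictly earlier, a
  shared particle), `IsUpstream R e e'` (its transitive closure: a chain of collisions sharing
  particles leads from `e` to `e'` forward in time; times strictly increase along chains,
  `IsUpstream.fst_lt`, so the order is irreflexive); `causalPast R a t` — the events upstream
  of, or equal to, some event of particle `a` before `t` (the information carried by `a` just
  before `t`; its particles are the running backward cluster of `a`, APST 2015 §1);
  `commonPast R i j t`; `lastCommonTime R t₀ i j t`;
* **ring closures** — `IsRingClosureIn R i j t`: some earlier event involving the partner `j` is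
  upstream of (or equal to) the last event of `i` before `t`, i.e. `j` occurs in the causal past
  of `i`: the re-encounter of dynamical information of the *ring events* of the kinetic theory
  of moderately dense gases (recollisions `(12)(13)(12)`, cyclic sequences `(12)(23)(31)`:
  Cohen 1967 §2 (13)–(14), §4; Kawasaki–Oppenheim 1967; Soto 2016 §4.8.2); the **excursion** is
  the time elapsed since the last common upstream event of `i` and `j`, and
  `IsLongRingClosureIn R i j t τ` asks it to exceed `τ` (`isLongRingClosureIn_iff`);
* along a curve `γ` with memory started at `t₀`: `IsRingClosure`, `IsLongRingClosure`,
  `ringExcursion`, `particleCollisionTimes`, `firstCollisionTimes`, and the **ring-closure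
  count** `ringClosureCount G ε γ t₀ i k τ` — the number of ring closures of the tagged particle
  `i` with excursion `> τ` among its first `k` collisions after `t₀` (`≤ k`,
  `ringClosureCount_le`); along a hard-sphere flow, as a function of the initial datum (memory
  and count from time `0`, junk `0` off the good set), `HardSphereFlow.ringClosureCount Φ i k τ z`;
* the torus model at packing fraction `φ` (`HardSphereEuler.lean`: `N + 1` spheres of diameter
  `hsDiameter σ N = σ (N+1)^{-1/3}` on `𝕋³`, filling the fraction `π σ³ / 6`):
  `reducedDiameterOfPacking φ = (6φ/π)^{1/3}`, the Boltzmann mean free time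
  `hsMeanFreeTime σ N = (4 √π (N+1) ε_N²)⁻¹`, the per-collision expectation
  `meanRingClosureRate σ N Φ k τ` under the equilibrium law `localGibbsLaw σ 1 0 1 N Φ`, and the
  **dressed ring bubble** `dressedRingBubble φ = ⨆_{k ≥ 1} limsup_N ⨆_Φ k⁻¹ E_G[count] : ℝ≥0∞` —
  the expected number of ring closures per collision whose excursion exceeds one mean free time.

## Conventions and design choices

* MEMORY WINDOW. The status of the collision at time `t` is decided by the collisions in
  `(t₀, t)`: the record is `collisionRecord G ε γ t₀ t` (window `(t₀, t]`) and causal chains end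
  strictly before `t`. For the flow `t₀ = 0`: correlations present in the (Gibbs) initial datum
  are not dynamical information. The first collision of a particle after `t₀` is never a ring
  closure (`causalPast` is empty).
* ALL CHAIN LENGTHS COUNT, as requested ("genuine recollisions and cyclic collision sequences
  included"): `IsUpstream` is a transitive closure with no bound on the number of intermediate
  collisions or particles. The count is per tagged particle and at most `k`.
* EXCURSION is symmetric in the pair: `t` minus the latest time of an event upstream of both `i`
  and `j` before `t` (`lastCommonTime`, junk default `t₀` when there is none — never the case at a
  ring closure, `IsRingClosureIn.commonPast_nonempty`); "excursion `> τ`" is *stated* as "every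
  common upstream event is older than `t - τ`" and shown equivalent (`isLongRingClosureIn_iff`).
* Several pairs in contact at one time (excluded on hard-sphere trajectories,
  `IsHardSphereTrajectory.binary`) do not influence each other; "the partner" is then "some
  partner". Infinitely many collisions in a window give the junk values of `collisionWindow`.
* THRESHOLD. `dressedRingBubble` uses one Boltzmann mean free time of the dilute gas at unit
  temperature, `(4 √π n ε²)⁻¹`, `n = N + 1` (collision frequency `n π ε² ⟨|v - v'|⟩` with
  `⟨|v - v'|⟩ = 4/√π` for unit-temperature Maxwellians; Soto 2016 §4.8.2: free flights are
  limited by the mean free time `τ ∼ 1/(c_th D^{d-1} n)`); the Enskog factor `χ(φ) = 1 + O(φ)` is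
  not included. Shorter re-encounters are not counted by `dressedRingBubble` (the route books
  them as a quasi-local three-body vertex); `ringClosureCount` has the threshold as a parameter.
* EXPECTATION: a lower Lebesgue integral in `ℝ≥0∞` of the label-averaged count
  `(N+1)⁻¹ ∑ᵢ`, under `localGibbsLaw σ 1 0 1 N Φ` (unit activity and temperature, no drift).
  Measurability of `z ↦ Φ.ringClosureCount i k τ z` is not proved here (cf.
  `BackwardClusterMeasurable.lean`). The flow enters through `⨆ Φ`: hard-sphere flows on `𝕋³`
  exist for `ε_N < 1/2` (`HardSphereFlow.nonempty_torus_holds`) and any two agree Liouville-a.e.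
  with forward-unique orbits (`HardSphereFlow.flow_eq_ae`, `IsHardSphereTrajectory.unique`),
  while the Gibbs law is absolutely continuous; for the finitely many `N` without a flow the
  supremum is the junk value `0`. `limsup` in `N`, then `⨆` over `k ≥ 1` (written `k + 1`).
  Values lie in `[0, 1]` for probability laws (`meanRingClosureRate_le`).
* Nothing is claimed here about the size of `R(φ)` (the route expects `O(φ² log(1/φ))` in
  `d = 3` and a logarithmic divergence with the horizon for discs: its item `DressedBubbleBound`).

## References

* E. G. D. Cohen, *On the non-existence of density expansions for the transport coefficients in
  classical gases*, in: Statistical Mechanics, Foundations and Applications (IUPAP Copenhagen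
  1966), Benjamin 1967, pp. 291–312, §2 (13)–(14), §4a–b. K. Kawasaki, I. Oppenheim, ibid.
  pp. 313–334 (ring diagrams).
* R. Soto, *Kinetic Theory and Transport Phenomena*, OUP 2016, §4.8.2 (recollision events,
  `dN₃/dt ∼ φ³ ∫ dt₂₃ / t₂₃^{d-1}`, mean-free-time cut-off).
* K. Aoki, M. Pulvirenti, S. Simonella, T. Tsuji, M3AS 25 (2015) 995–1010, §1, §5 (backward
  clusters, collision record); M. Pulvirenti, S. Simonella, DCDS 41 (2021), §1.1 (recollisions).
* I. Gallagher, L. Saint-Raymond, B. Texier, *From Newton to Boltzmann* (2013), §4.1.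
-/

open Set Filter
open _root_.MeasureTheory
open scoped ENNReal

namespace Literature.MathematicalPhysics.KineticTheory

noncomputable section

open Literature.Analysis.FluidPDE

variable {d : Type*} [Fintype d] {X : Type*} {N : ℕ}

/-! ## The causal order on a record of collision events -/

/-- Direct causal precedence between two events `(time, pair)` of a record `R`: both belong to
`R`, `e` happens strictly before `e'`, and they share a particle (which carries the dynamical
information of `e` into `e'`). [folklore] -/
def DirectlyPrecedes (R : Finset (ℝ × Sym2 (Fin N))) (e e' : ℝ × Sym2 (Fin N)) : Prop :=
  e ∈ R ∧ e' ∈ R ∧ e.1 < e'.1 ∧ ∃ a, a ∈ e.2 ∧ a ∈ e'.2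

/-- `IsUpstream R e e'`: the event `e` is causally *upstream* of `e'` in the record `R` — a chain
of collisions of `R` sharing particles leads from `e` to `e'` forward in time (the transitive
closure of `DirectlyPrecedes R`). [folklore] -/
def IsUpstream (R : Finset (ℝ × Sym2 (Fin N))) : ℝ × Sym2 (Fin N) → ℝ × Sym2 (Fin N) → Prop :=
  Relation.TransGen (DirectlyPrecedes R)

namespace IsUpstream

variable {R : Finset (ℝ × Sym2 (Fin N))} {e e' e'' : ℝ × Sym2 (Fin N)}

/-- Times strictly increase along causal chains. [folklore] -/
theorem fst_lt (h : IsUpstream R e e') : e.1 < e'.1 := by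
  induction h with
  | single h => exact h.2.2.1
  | tail _ h ih => exact ih.trans h.2.2.1

/-- An upstream event belongs to the record. [folklore] -/
theorem left_mem (h : IsUpstream R e e') : e ∈ R := by
  induction h with
  | single h => exact h.1
  | tail _ _ ih => exact ih

/-- A downstream event belongs to the record. [folklore] -/
theorem right_mem (h : IsUpstream R e e') : e' ∈ R := by
  induction h with
  | single h => exact h.2.1
  | tail _ h _ => exact h.2.1

/-- The causal order is transitive. [folklore] -/
theorem trans (h : IsUpstream R e e') (h' : IsUpstream R e' e'') : IsUpstream R e e'' :=
  Relation.TransGen.trans h h'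

end IsUpstream

/-- The causal order is irreflexive: no event is upstream of itself. [folklore] -/
theorem not_isUpstream_self (R : Finset (ℝ × Sym2 (Fin N))) (e : ℝ × Sym2 (Fin N)) :
    ¬ IsUpstream R e e :=
  fun h => lt_irrefl _ h.fst_lt

/-! ## Causal past, ring closures and excursions in a record -/

section Record

variable {R : Finset (ℝ × Sym2 (Fin N))} {a i j : Fin N} {t t₀ τ τ' : ℝ} {e : ℝ × Sym2 (Fin N)}

open scoped Classical in
/-- The *causal past* of particle `a` just before time `t` in the record `R`: the events of `R`
upstream of, or equal to, some event of `a` at a time `< t` — equivalently (chaining along `a`)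
upstream of or equal to the last event of `a` before `t`. Its particles form the running
backward cluster of `a` over the window (APST 2015 §1). [folklore] -/
def causalPast (R : Finset (ℝ × Sym2 (Fin N))) (a : Fin N) (t : ℝ) : Finset (ℝ × Sym2 (Fin N)) :=
  R.filter fun e => ∃ e' ∈ R, e'.1 < t ∧ a ∈ e'.2 ∧ Relation.ReflTransGen (DirectlyPrecedes R) e e'

/-- Membership in the causal past. [folklore] -/
theorem mem_causalPast : e ∈ causalPast R a t ↔
    e ∈ R ∧ ∃ e' ∈ R, e'.1 < t ∧ a ∈ e'.2 ∧ Relation.ReflTransGen (DirectlyPrecedes R) e e' := by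
  classical
  simp only [causalPast, Finset.mem_filter]

/-- Events of the causal past before `t` happen before `t`. [folklore] -/
theorem fst_lt_of_mem_causalPast (h : e ∈ causalPast R a t) : e.1 < t := by
  obtain ⟨-, e', -, ht, -, hch⟩ := mem_causalPast.1 h
  rcases Relation.reflTransGen_iff_eq_or_transGen.1 hch with rfl | htr
  · exact ht
  · exact (IsUpstream.fst_lt htr).trans ht

/-- An event of `a` before `t` belongs to the causal past of `a`. [folklore] -/
theorem mem_causalPast_self (he : e ∈ R) (ht : e.1 < t) (ha : a ∈ e.2) : e ∈ causalPast R a t :=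
  mem_causalPast.2 ⟨he, e, he, ht, ha, Relation.ReflTransGen.refl⟩

/-- The common causal past of `i` and `j` just before `t`: the events upstream of (or equal to)
both an event of `i` and an event of `j` before `t`. [folklore] -/
def commonPast (R : Finset (ℝ × Sym2 (Fin N))) (i j : Fin N) (t : ℝ) :
    Finset (ℝ × Sym2 (Fin N)) :=
  causalPast R i t ∩ causalPast R j t

/-- The time of the *last common upstream event* of `i` and `j` before `t` (junk default `t₀`,
the start of the memory, if there is none). [folklore] -/
def lastCommonTime (R : Finset (ℝ × Sym2 (Fin N))) (t₀ : ℝ) (i j : Fin N) (t : ℝ) : ℝ :=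
  ((commonPast R i j t).image Prod.fst).max.unbotD t₀

/-- `IsRingClosureIn R i j t`: particle `j` is causally upstream of particle `i` just before
`t` — some event of `R` involving `j` is upstream of, or equal to, an event of `i` before `t`.
A collision of `i` with partner `j` at time `t` is then a **ring closure** for `i` (re-encounter
of dynamical information; the reflexive case is a genuine recollision of the pair `{i, j}`, a
chain `i → k₁ → ⋯ → j` closing on `i` a cyclic collision sequence, seen from the particle that
receives the information). The notion posited by route `LaceRingBootstrap` of
`AtomisticToContinuum/HydrodynamicLimit`, after the ring events of the kinetic theory of dense
gases (Cohen 1967 §2, §4; Kawasaki–Oppenheim 1967). [folklore] -/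
def IsRingClosureIn (R : Finset (ℝ × Sym2 (Fin N))) (i j : Fin N) (t : ℝ) : Prop :=
  ∃ e ∈ causalPast R i t, j ∈ e.2

/-- `IsLongRingClosureIn R i j t τ`: a ring closure whose *excursion* exceeds `τ` — every common
upstream event of `i` and `j` before `t` is older than `t - τ` (the information re-encountered
at `t` separated more than `τ` ago). [folklore] -/
def IsLongRingClosureIn (R : Finset (ℝ × Sym2 (Fin N))) (i j : Fin N) (t τ : ℝ) : Prop :=
  IsRingClosureIn R i j t ∧ ∀ c ∈ commonPast R i j t, c.1 < t - τ

/-- At a ring closure the common causal past is nonempty (the witnessing event of `j` is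
upstream of `i` and trivially of `j`). [folklore] -/
theorem IsRingClosureIn.commonPast_nonempty (h : IsRingClosureIn R i j t) :
    (commonPast R i j t).Nonempty := by
  obtain ⟨e, he, hj⟩ := h
  exact ⟨e, Finset.mem_inter.2
    ⟨he, mem_causalPast_self (mem_causalPast.1 he).1 (fst_lt_of_mem_causalPast he) hj⟩⟩

/-- A long ring closure is a ring closure. [folklore] -/
theorem IsLongRingClosureIn.isRingClosureIn (h : IsLongRingClosureIn R i j t τ) :
    IsRingClosureIn R i j t :=
  h.1

/-- Lowering the excursion threshold keeps a long ring closure long. [folklore] -/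
theorem IsLongRingClosureIn.anti (h : IsLongRingClosureIn R i j t τ') (hτ : τ ≤ τ') :
    IsLongRingClosureIn R i j t τ :=
  ⟨h.1, fun c hc => (h.2 c hc).trans_le (by linarith)⟩

/-- With a nonempty common past, the last common time is the maximum of its times. [folklore] -/
theorem lastCommonTime_eq_max' (hne : (commonPast R i j t).Nonempty) (t₀ : ℝ) :
    lastCommonTime R t₀ i j t = ((commonPast R i j t).image Prod.fst).max' (hne.image _) := by
  rw [lastCommonTime, ← Finset.coe_max', WithBot.unbotD_coe]

/-- With a nonempty common past, "every common upstream event is older than `u`" means "the last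
common time is `< u`". [folklore] -/
theorem forall_mem_commonPast_fst_lt_iff (hne : (commonPast R i j t).Nonempty) (t₀ u : ℝ) :
    (∀ c ∈ commonPast R i j t, c.1 < u) ↔ lastCommonTime R t₀ i j t < u := by
  rw [lastCommonTime_eq_max' hne, Finset.max'_lt_iff, Finset.forall_mem_image]

/-- **Excursion form.** A long ring closure is a ring closure whose excursion
`t - lastCommonTime` exceeds `τ` (whatever the default `t₀`). [folklore] -/
theorem isLongRingClosureIn_iff (t₀ : ℝ) : IsLongRingClosureIn R i j t τ ↔
    IsRingClosureIn R i j t ∧ τ < t - lastCommonTime R t₀ i j t := by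
  constructor
  · rintro ⟨h, hτ⟩
    have := (forall_mem_commonPast_fst_lt_iff h.commonPast_nonempty t₀ (t - τ)).1 hτ
    exact ⟨h, by linarith⟩
  · rintro ⟨h, hτ⟩
    exact ⟨h, (forall_mem_commonPast_fst_lt_iff h.commonPast_nonempty t₀ (t - τ)).2 (by linarith)⟩

end Record

/-! ## Along a curve in phase space: ring closures of a tagged particle and their count -/

section Curve

variable (G : Geometry d X) (ε : ℝ) (γ : ℝ → Config N d X)

/-- The collision of particle `i` at time `t` along `γ` is a **ring closure** (memory started at
time `t₀`): `i` is in contact with a partner `j` at time `t` and `j` is causally upstream of `i`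
through the collisions of `γ` in `(t₀, t)`. [folklore] -/
def IsRingClosure (t₀ : ℝ) (i : Fin N) (t : ℝ) : Prop :=
  ∃ j, s(i, j) ∈ contactPairSet G ε (γ t) ∧ IsRingClosureIn (collisionRecord G ε γ t₀ t) i j t

/-- A ring closure of particle `i` at time `t` along `γ` with excursion `> τ` (memory started at
`t₀`). [folklore] -/
def IsLongRingClosure (t₀ : ℝ) (i : Fin N) (t τ : ℝ) : Prop :=
  ∃ j, s(i, j) ∈ contactPairSet G ε (γ t) ∧
    IsLongRingClosureIn (collisionRecord G ε γ t₀ t) i j t τ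

/-- The *excursion* of the pair `{i, j}` at time `t` along `γ`: the time elapsed since the last
common upstream event of `i` and `j` among the collisions in `(t₀, t)` (junk value `t - t₀` if
there is none). [folklore] -/
def ringExcursion (t₀ : ℝ) (i j : Fin N) (t : ℝ) : ℝ :=
  t - lastCommonTime (collisionRecord G ε γ t₀ t) t₀ i j t

/-- The collision times of particle `i` along `γ`: the times at which `i` is in contact with
another particle. [folklore] -/
def particleCollisionTimes (i : Fin N) : Set ℝ :=
  {t | ∃ j, s(i, j) ∈ contactPairSet G ε (γ t)}

/-- The first `k` collision times of particle `i` after time `t₀`: the collision times `t > t₀`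
of `i` with at most `k` collision times of `i` in `(t₀, t]` (finitely many: for a curve with
infinitely many collisions of `i` right after `t₀` the set is empty). [folklore] -/
def firstCollisionTimes (t₀ : ℝ) (i : Fin N) (k : ℕ) : Set ℝ :=
  {t | t ∈ particleCollisionTimes G ε γ i ∧ t₀ < t ∧
    (particleCollisionTimes G ε γ i ∩ Ioc t₀ t).Finite ∧
    (particleCollisionTimes G ε γ i ∩ Ioc t₀ t).ncard ≤ k}

/-- **The ring-closure count** `Φ_i(k, τ)`: the number of ring closures of particle `i` with
excursion `> τ` among its first `k` collisions after time `t₀` along `γ`, the memory starting at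
`t₀` (object posited by route `LaceRingBootstrap`). [folklore] -/
def ringClosureCount (t₀ : ℝ) (i : Fin N) (k : ℕ) (τ : ℝ) : ℕ :=
  {t ∈ firstCollisionTimes G ε γ t₀ i k | IsLongRingClosure G ε γ t₀ i t τ}.ncard

variable {G ε γ} {t₀ t τ τ' : ℝ} {i j : Fin N} {k k' : ℕ}

/-- A long ring closure is a ring closure. [folklore] -/
theorem IsLongRingClosure.isRingClosure (h : IsLongRingClosure G ε γ t₀ i t τ) :
    IsRingClosure G ε γ t₀ i t := by
  obtain ⟨j, hj, h⟩ := h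
  exact ⟨j, hj, h.isRingClosureIn⟩

/-- Lowering the threshold keeps a long ring closure long. [folklore] -/
theorem IsLongRingClosure.anti (h : IsLongRingClosure G ε γ t₀ i t τ') (hτ : τ ≤ τ') :
    IsLongRingClosure G ε γ t₀ i t τ := by
  obtain ⟨j, hj, h⟩ := h
  exact ⟨j, hj, h.anti hτ⟩

/-- Excursion form of a long ring closure along a curve. [folklore] -/
theorem isLongRingClosure_iff : IsLongRingClosure G ε γ t₀ i t τ ↔
    ∃ j, s(i, j) ∈ contactPairSet G ε (γ t) ∧
      IsRingClosureIn (collisionRecord G ε γ t₀ t) i j t ∧ τ < ringExcursion G ε γ t₀ i j t := by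
  simp only [IsLongRingClosure, isLongRingClosureIn_iff t₀, ringExcursion]

/-- Collision times of a particle are collision times of the curve. [folklore] -/
theorem particleCollisionTimes_subset_collisionTimes :
    particleCollisionTimes G ε γ i ⊆ collisionTimes G ε γ := fun _ ⟨_, hj⟩ =>
  mem_collisionTimes_iff_contactPairSet_nonempty.2 ⟨_, hj⟩

/-- There are at most `k` "first `k` collision times" (and they form a finite set). [folklore] -/
theorem finite_firstCollisionTimes (t₀ : ℝ) (i : Fin N) (k : ℕ) :
    (firstCollisionTimes G ε γ t₀ i k).Finite ∧ (firstCollisionTimes G ε γ t₀ i k).ncard ≤ k := by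
  set A := firstCollisionTimes G ε γ t₀ i k
  have key : ∀ B : Set ℝ, B ⊆ A → B.Finite → B.ncard ≤ k := by
    intro B hBA hB
    rcases B.eq_empty_or_nonempty with rfl | hne
    · simp
    obtain ⟨m, hmB, hm⟩ := Set.exists_max_image B id hB hne
    obtain ⟨-, -, hfin, hcard⟩ := hBA hmB
    refine (Set.ncard_le_ncard (fun b hb => ?_) hfin).trans hcard
    exact ⟨(hBA hb).1, (hBA hb).2.1, hm b hb⟩
  have hA : A.Finite := by
    by_contra hinf
    obtain ⟨B, hBA, hB, hcard⟩ := Set.Infinite.exists_subset_ncard_eq hinf (k + 1)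
    have := key B hBA hB
    omega
  exact ⟨hA, key A Subset.rfl hA⟩

/-- **At most `k` ring closures among `k` collisions.** [folklore] -/
theorem ringClosureCount_le : ringClosureCount G ε γ t₀ i k τ ≤ k := by
  obtain ⟨hfin, hcard⟩ := finite_firstCollisionTimes (G := G) (ε := ε) (γ := γ) t₀ i k
  exact (Set.ncard_le_ncard (Set.sep_subset _ _) hfin).trans hcard

/-- The count grows with the number of collisions inspected. [folklore] -/
theorem ringClosureCount_mono (hk : k ≤ k') :
    ringClosureCount G ε γ t₀ i k τ ≤ ringClosureCount G ε γ t₀ i k' τ := by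
  refine Set.ncard_le_ncard
    (fun t ht => ⟨⟨ht.1.1, ht.1.2.1, ht.1.2.2.1, ht.1.2.2.2.trans hk⟩, ht.2⟩)
    ((finite_firstCollisionTimes t₀ i k').1.subset (Set.sep_subset _ _))

/-- The count decreases as the excursion threshold increases. [folklore] -/
theorem ringClosureCount_anti (hτ : τ ≤ τ') :
    ringClosureCount G ε γ t₀ i k τ' ≤ ringClosureCount G ε γ t₀ i k τ :=
  Set.ncard_le_ncard (fun _ ht => ⟨ht.1, ht.2.anti hτ⟩)
    ((finite_firstCollisionTimes t₀ i k).1.subset (Set.sep_subset _ _))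

end Curve

/-! ## Along the hard-sphere flow: the count as a function of the initial datum -/

section Flow

variable [MeasureSpace X] [TopologicalSpace X] {G : Geometry d X} {ε : ℝ}

open scoped Classical in
/-- The ring-closure count of the tagged particle `i` among its first `k` collisions along the
orbit `t ↦ Φ_t z`, memory and count starting at time `0`, threshold `τ` on the excursion; junk
value `0` off the good set of the flow (a Liouville-null set). [folklore] -/
def _root_.Literature.Analysis.FluidPDE.HardSphereFlow.ringClosureCount (Φ : HardSphereFlow G ε N)
    (i : Fin N) (k : ℕ) (τ : ℝ) (z : Config N d X) : ℕ :=
  if z ∈ Φ.good then KineticTheory.ringClosureCount G ε (fun t => Φ.flow t z) 0 i k τ else 0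

variable (Φ : HardSphereFlow G ε N) {i : Fin N} {k : ℕ} {τ : ℝ} {z : Config N d X}

/-- On the good set the flow version is the count along the orbit. [folklore] -/
theorem _root_.Literature.Analysis.FluidPDE.HardSphereFlow.ringClosureCount_apply
    (hz : z ∈ Φ.good) : Φ.ringClosureCount i k τ z =
      KineticTheory.ringClosureCount G ε (fun t => Φ.flow t z) 0 i k τ := by
  unfold HardSphereFlow.ringClosureCount
  exact if_pos hz

/-- Off the good set the count is the junk value `0`. [folklore] -/
theorem _root_.Literature.Analysis.FluidPDE.HardSphereFlow.ringClosureCount_apply_of_not_mem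
    (hz : z ∉ Φ.good) : Φ.ringClosureCount i k τ z = 0 := by
  unfold HardSphereFlow.ringClosureCount
  exact if_neg hz

/-- At most `k` ring closures among `k` collisions, along the flow. [folklore] -/
theorem _root_.Literature.Analysis.FluidPDE.HardSphereFlow.ringClosureCount_le :
    Φ.ringClosureCount i k τ z ≤ k := by
  by_cases hz : z ∈ Φ.good
  · rw [Φ.ringClosureCount_apply hz]
    exact KineticTheory.ringClosureCount_le
  · rw [Φ.ringClosureCount_apply_of_not_mem hz]
    exact Nat.zero_le _

end Flow

/-! ## The torus model at packing fraction `φ` and the dressed ring bubble -/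

/-- The reduced diameter `σ` of the packing fraction `φ`: `N + 1` spheres of diameter
`hsDiameter σ N = σ (N+1)^{-1/3}` in the unit torus occupy the volume fraction
`(N+1) · (π/6) ε_N³ = π σ³ / 6`, and `σ = (6φ/π)^{1/3}` solves `π σ³ / 6 = φ`. [folklore] -/
def reducedDiameterOfPacking (φ : ℝ) : ℝ :=
  (6 * φ / Real.pi) ^ (1 / 3 : ℝ)

/-- `π σ³ / 6 = φ` for the reduced diameter of a packing fraction `φ ≥ 0`. [folklore] -/
theorem packingFraction_reducedDiameterOfPacking {φ : ℝ} (hφ : 0 ≤ φ) :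
    Real.pi * reducedDiameterOfPacking φ ^ 3 / 6 = φ := by
  have hx : 0 ≤ 6 * φ / Real.pi := by positivity
  have h3 : reducedDiameterOfPacking φ ^ 3 = 6 * φ / Real.pi := by
    rw [reducedDiameterOfPacking, ← Real.rpow_natCast, ← Real.rpow_mul hx]
    norm_num
  rw [h3]
  field_simp

/-- The **Boltzmann mean free time** of the torus model at reduced diameter `σ` and unit
temperature: `N + 1` spheres of diameter `ε_N = hsDiameter σ N` in the unit torus have collision
frequency `n π ε_N² ⟨|v - v'|⟩ = 4 √π (N+1) ε_N²` per particle (`⟨|v - v'|⟩ = 4/√π` for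
unit-temperature Maxwellians), whose inverse `(4 √π (N+1) ε_N²)⁻¹ = (4 √π σ² (N+1)^{1/3})⁻¹` is
the mean free time (dilute-gas value; the Enskog contact factor `χ` is not included). [folklore] -/
def hsMeanFreeTime (σ : ℝ) (N : ℕ) : ℝ :=
  (4 * Real.sqrt Real.pi * ((N + 1 : ℕ) : ℝ) * hsDiameter σ N ^ 2)⁻¹

/-- The **expected number of ring closures per collision** in the torus model: `k⁻¹` times the
expectation, under the equilibrium hard-sphere Gibbs law `localGibbsLaw σ 1 0 1 N Φ` (unit
activity and temperature, no drift), of the label-averaged ring-closure count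
`(N+1)⁻¹ ∑ᵢ Φ.ringClosureCount i k τ` among the first `k` collisions with excursion `> τ`
(a lower Lebesgue integral in `ℝ≥0∞`). [folklore] -/
def meanRingClosureRate (σ : ℝ) (N : ℕ)
    (Φ : HardSphereFlow (Torus.geometry (Fin 3)) (hsDiameter σ N) (N + 1)) (k : ℕ) (τ : ℝ) :
    ℝ≥0∞ :=
  (k : ℝ≥0∞)⁻¹ * ∫⁻ z, ((N + 1 : ℕ) : ℝ≥0∞)⁻¹ * ∑ i, (Φ.ringClosureCount i k τ z : ℝ≥0∞)
    ∂(localGibbsLaw σ (fun _ => 1) (fun _ => 0) (fun _ => 1) N Φ)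

/-- The per-collision expectation is at most the total mass of the law (`≤ 1` for a probability
law): there are at most `k` ring closures among `k` collisions. [folklore] -/
theorem meanRingClosureRate_le (σ : ℝ) (N : ℕ)
    (Φ : HardSphereFlow (Torus.geometry (Fin 3)) (hsDiameter σ N) (N + 1)) (k : ℕ) (τ : ℝ) :
    meanRingClosureRate σ N Φ k τ ≤
      localGibbsLaw σ (fun _ => 1) (fun _ => 0) (fun _ => 1) N Φ Set.univ := by
  set μ := localGibbsLaw σ (fun _ => 1) (fun _ => 0) (fun _ => 1) N Φ
  have hb : ∀ z, ((N + 1 : ℕ) : ℝ≥0∞)⁻¹ * ∑ i, (Φ.ringClosureCount i k τ z : ℝ≥0∞) ≤ k := by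
    intro z
    calc ((N + 1 : ℕ) : ℝ≥0∞)⁻¹ * ∑ i, (Φ.ringClosureCount i k τ z : ℝ≥0∞)
        ≤ ((N + 1 : ℕ) : ℝ≥0∞)⁻¹ * ∑ _i : Fin (N + 1), (k : ℝ≥0∞) := by
          gcongr with i
          exact_mod_cast Φ.ringClosureCount_le
      _ = k := by
          rw [Finset.sum_const, Finset.card_univ, Fintype.card_fin, nsmul_eq_mul, ← mul_assoc,
            ENNReal.inv_mul_cancel (by simp) (ENNReal.natCast_ne_top _), one_mul]
  calc meanRingClosureRate σ N Φ k τ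
      ≤ (k : ℝ≥0∞)⁻¹ * ∫⁻ _z, (k : ℝ≥0∞) ∂μ := by
        unfold meanRingClosureRate
        gcongr
        exact hb _
    _ = (k : ℝ≥0∞)⁻¹ * k * μ Set.univ := by rw [lintegral_const, mul_assoc]
    _ ≤ μ Set.univ := by
        rcases Nat.eq_zero_or_pos k with rfl | hk
        · simp
        · rw [ENNReal.inv_mul_cancel (by exact_mod_cast hk.ne') (ENNReal.natCast_ne_top k),
            one_mul]

/-- **The dressed ring bubble `R(φ)`** of route `LaceRingBootstrap`: the supremum over `k ≥ 1` of
`k⁻¹ ·` the (`limsup` in `N` of the) expected number of ring closures with excursion longer than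
one Boltzmann mean free time among the first `k` collisions of a tagged particle, under the
equilibrium hard-sphere Gibbs law of `N + 1` spheres of diameter `σ (N+1)^{-1/3}` on `𝕋³` at
packing fraction `φ = π σ³ / 6`, the dynamics being any hard-sphere flow (`⨆ Φ`; flows agree
Liouville-a.e. and exist for `ε_N < 1/2`). [folklore] -/
def dressedRingBubble (φ : ℝ) : ℝ≥0∞ :=
  ⨆ k : ℕ, limsup (fun N : ℕ =>
    ⨆ Φ : HardSphereFlow (Torus.geometry (Fin 3))
        (hsDiameter (reducedDiameterOfPacking φ) N) (N + 1),
      meanRingClosureRate (reducedDiameterOfPacking φ) N Φ (k + 1)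
        (hsMeanFreeTime (reducedDiameterOfPacking φ) N)) atTop

end

end Literature.MathematicalPhysics.KineticTheory
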